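import Literature.Analysis.FluidPDE.NSBoundedMildOseen
import Literature.Analysis.FluidPDE.KNSSRemark61
import Literature.Analysis.FluidPDE.KochTataruPointwise
import Literature.Analysis.FunctionSpaces.LittlewoodPaleyDifferenceProofs
import Literature.Analysis.FunctionSpaces.LittlewoodPaleyBernsteinProofs
import Literature.Analysis.FluidPDE.FujitaKatoHeatWeights
import Mathlib.MeasureTheory.Function.L2Space
import HarnessLib

/-!
# The Oseen–Duhamel term of bounded fields has no large-scale mean: `Ṡ_j B^ν_s(u, v)(t) → 0`

Analysis/FluidPDE support file (everything proved) on the discharge path of the named fact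
`Literature.Analysis.FluidPDE.oseenMild_of_bounded_isBesovMildSolutionOn` ((A) of
`NSBoundedMildOseen.lean`), itself the first brick under
`Literature.Analysis.FluidPDE.knss_classical_of_bounded_isBesovMildSolutionOn`
(`NSCriticalClosureBesovBounded.lean`) and hence under the critical Besov continuation criterion
`Literature.Analysis.FluidPDE.hasSmoothExtensionPast_of_eHomBesovNorm_bounded`
(Gallagher–Koch–Planchon 2016, Thm. 1).

## The point

Fact (A) identifies a bounded Besov mild solution `u` (duality form) with its Oseen integral form
`u(t) = e^{νtΔ}u(0) - B^ν_0(u,u)(t)` a.e., *without* the parasitic drift `b(t)` of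
Koch–Nadirashvili–Seregin–Šverák 2009, Lemma 3.1. Testing against solenoidal fields and the
annihilator/Liouville lemma only give `u(t) = e^{νtΔ}u(0) - B^ν_0(u,u)(t) + c(t)` with a constant
`c(t)`; the constant is killed by the realisation condition `Ṡ_j U(t) → 0` (`j → -∞`) of the
homogeneous Besov class (Bahouri–Chemin–Danchin, Def. 1.26) **provided the other two terms are
realised as well**. For the caloric term this is `Ṡ_j e^{tΔ} = e^{tΔ} Ṡ_j`; for the bilinear term
`B^ν_0(u,u)(t)`, which is merely a bounded function (and `Ṡ_j c = c ≠ 0` for constants), it is the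
content of this file:

* `tendsto_lowFreqCutoff_oseenDuhamel_atBot`: for `ν > 0`, `s ≤ t` and jointly measurable fields
  `u, v` bounded on `(s, t) × ℝ^ι`, every tempered distribution `V` of
  `x ↦ B^ν_s(u, v)(t)(x) = oseenDuhamel ν s u v t x` satisfies `Ṡ_j V → 0` in `𝓢'` as `j → -∞`;
  `tendsto_lowFreqCutoff_oseenDuhamel_atBot_of_eLpNorm_le`: the same under slice-wise essential
  bounds (the hypotheses of `NSBoundedMildOseen.lean`), via bounded radial retractions and
  `oseenDuhamel_congr_ae`;
* `exists_isDistributionOf_oseenDuhamel`, `norm_oseenDuhamel_le_of_bound`,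
  `aestronglyMeasurable_oseenDuhamel_of_bound`, `oseenDuhamel_eq_integral_prod_of_bound`: the Duhamel term
  of bounded fields is an absolutely convergent integral over `(s, t) × ℝ^ι`, bounded by
  `M_u M_v m ν^{-1/2} 2(t-s)^{1/2}` (KNSS 2009, §4: `‖B(u,v)‖ ≤ C√T ‖u‖ ‖v‖`), measurable, and
  represented by a tempered distribution.

## Proof

1. **Cancellation** (`integral_oseenKernel_eq_zero`, `KNSSRemark61.lean`): `∫ K(σ, z)[a, b] dz = 0`
   (the Oseen–Koch–Tataru kernel is odd in `z`; equivalently its Fourier symbol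
   `2πi⟨ξ, a⟩ Ĝ_σ(ξ) P(ξ) b`, Koch–Tataru 2001, (8), vanishes at `ξ = 0`).
2. **Test side** (`section TestSide`, `section DyadicKernel`): `⟨Ṡ_j V, φ⟩ = ⟨V, φ ⋆ η_j⟩` with
   `η_j = 𝓕χ(2^{-j}·) = 2^{jd} η₀(2^j ·)` (`lowFreqFourierKernel_apply`, by the tree's
   `FunctionSpaces.fourier_comp_smul`), whose `L¹` translation moduli `Ω_{η_j}(z) = ∫ ‖η_j(w + z) - η_j(w)‖ dw = Ω_{η₀}(2^j z)`
   are bounded by `2‖η₀‖₁` and tend to `0` as `j → -∞` (continuity of translation in `L¹` for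
   Schwartz functions, by dominated convergence under the Schwartz decay).
3. **Large-scale means** (`enorm_integral_smul_complexify_oseenDuhamel_le`): by Fubini on
   `ℝ^ι × ((s,t) × ℝ^ι)` (the integrand being dominated by `‖θ(x)‖ M_u M_v k(ν(t-τ), x - y)`, `k`
   the parabolic majorant `C(σ + ‖z‖²)^{-(d+1)/2}` of Koch–Tataru's bound (14)), the cancellation
   `∫ θ(x) K(σ, x-y)[a,b] dx = ∫ (θ(z+y) - θ(y)) K(σ, z)[a,b] dz` and Tonelli,
   `‖∫ θ(x - y₀) B(x) dx‖ ≤ M_u M_v Φ(θ)` uniformly in `y₀`, with the defect functional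
   `Φ(θ) = ∫_{(s,t)} ∫ k(ν(t-τ), z) Ω_θ(z) dz dτ` (`oseenLowFreqDefect`).
4. **Dominated convergence** (`tendsto_oseenLowFreqDefect_atBot`): `Φ(η_j) → 0`, the dominating
   function `2‖η₀‖₁ k` having integral `2‖η₀‖₁ m ν^{-1/2} 2(t-s)^{1/2}`.
5. **Assembly**: `|⟨Ṡ_j V, φ⟩| ≤ ‖φ‖₁ M_u M_v Φ(η_j) → 0` for every Schwartz `φ`.

## Mathlib / tree search

Tree: `oseenDuhamel` (`NSBoundedMildOseen`), `oseenKernel`, `exists_norm_oseenKernel_le`,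
`exists_lintegral_enorm_oseenKernel_le`, `measurable_oseenKernel` (`KochTataruKernel`),
`integral_oseenKernel_eq_zero` (`KNSSRemark61`), `AEMeasurable.oseenKernel_comp`
(`KochTataruPointwise`), the bounded-field twins `oseenDuhamel_eq_integral_prod`,
`exists_norm_oseenDuhamel_bounded_le`, `aestronglyMeasurable_oseenDuhamel`,
`oseenDuhamel_congr_ae_slice` of `NSBoundedMildOseenDuhamel` (stated there for one bound `M`,
`s < t ≤ T` and the restricted volume; that file sits at a higher import layer and is not
importable here; the versions below — `oseenDuhamel_eq_integral_prod_of_bound`,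
`norm_oseenDuhamel_le_of_bound`, `aestronglyMeasurable_oseenDuhamel_of_bound`,
`oseenDuhamel_congr_ae` — with two bounds, `s ≤ t` and the product measure, are the forms
consumed by the Fubini arguments of this file), `FunctionSpaces.fourier_comp_smul`,
`FunctionSpaces.tendsto_two_zpow_atBot`, `lowFreqCutoff`, `lowFreqSymbolSchwartz`,
`fourier_smulLeftCLM_fourierInv_apply_eq_integral`, `integral_integral_smul_Lp_swap`
(`LittlewoodPaley*`), `FujitaKato.lintegral_Ioc_sub_rpow`, `volume_restrict_prod_univ_eq_prod`,
`radialRetract_eq_self` (`BoundedRepresentative`). `lean search 'lowFreqCutoff.*oseen|oseen.*lowFreq|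
integral_oseenKernel_eq_zero'`: nothing before this file. Mathlib: `Measure.integral_comp_smul`,
`integral_integral_swap`, `lintegral_lintegral_swap`, `tendsto_lintegral_filter_of_dominated_convergence`,
`TemperedDistribution.fourierMultiplierCLM_apply_apply`, `Lp.toTemperedDistribution`,
`SchwartzMap.one_add_le_sup_seminorm_apply`, `integrable_one_add_norm`.

## References

* G. Koch, N. Nadirashvili, G. Seregin, V. Šverák, *Liouville theorems for the Navier–Stokes
  equations and applications*, Acta Math. 203 (2009) 83–105 = arXiv:0709.3599, §3 p. 6 (the
  Oseen kernel `K_{ijk} = ∂_k K_{ij}`, `|K_{ijk}| ≤ C(|x|² + t)^{-(n+1)/2}`), §4 p. 8 (the bilinear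
  form `B(u,v)` and `‖B(u,v)‖ ≤ C√T‖u‖‖v‖`). [KochNadirashviliSereginSverak2009]
* H. Koch, D. Tataru, *Well-posedness for the Navier–Stokes equations*, Adv. Math. 157 (2001),
  §2 (8) (the kernel of `Π∇S(t)` and its symbol), §3 (14). [KochTataruAdvMath2001]
* H. Bahouri, J.-Y. Chemin, R. Danchin, *Fourier Analysis and Nonlinear PDE* (2011), Def. 1.26
  (the realisation condition `Ṡ_j u → 0` of `𝓢'_h`), (2.5). [BahouriCheminDanchin2011]
-/

noncomputable section

open MeasureTheory Set Function Filter TopologicalSpace FourierTransform InnerProductSpace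
open _root_.Topology
open scoped SchwartzMap ENNReal NNReal RealInnerProductSpace

namespace Literature.Analysis.FluidPDE

/-! ## Test-function side: Fourier transforms of dilated symbols, translation moduli -/

section TestSide

variable {E : Type*} [NormedAddCommGroup E] [InnerProductSpace ℝ E] [FiniteDimensional ℝ E]
  [MeasurableSpace E] [BorelSpace E]

/-- The **`L¹` translation modulus** `Ω_θ(h) = ∫ ‖θ(w + h) - θ(w)‖ dw` of a function `θ`. [folklore] -/
def translationModulus {F : Type*} [NormedAddCommGroup F] (θ : E → F) (h : E) : ℝ :=
  ∫ w, ‖θ (w + h) - θ w‖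

/-- `Ω_θ(h) ≥ 0`. [folklore] -/
theorem translationModulus_nonneg {F : Type*} [NormedAddCommGroup F] (θ : E → F) (h : E) :
    0 ≤ translationModulus θ h :=
  integral_nonneg fun _ => norm_nonneg _

/-- `Ω_θ(h) ≤ 2 ‖θ‖_{L¹}` for integrable `θ`. [folklore] -/
theorem translationModulus_le {F : Type*} [NormedAddCommGroup F] {θ : E → F}
    (hθ : Integrable θ) (h : E) :
    translationModulus θ h ≤ 2 * ∫ w, ‖θ w‖ := by
  unfold translationModulus
  have h1 : Integrable (fun w => θ (w + h)) := hθ.comp_add_right h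
  calc ∫ w, ‖θ (w + h) - θ w‖ ≤ ∫ w, (‖θ (w + h)‖ + ‖θ w‖) :=
        integral_mono (h1.sub hθ).norm (h1.norm.add hθ.norm) fun w => norm_sub_le _ _
    _ = (∫ w, ‖θ (w + h)‖) + ∫ w, ‖θ w‖ := integral_add h1.norm hθ.norm
    _ = 2 * ∫ w, ‖θ w‖ := by
        rw [integral_add_right_eq_self (fun w => ‖θ w‖) h]; ring

/-- Peetre's inequality in the form `1 + ‖w‖ ≤ (1 + ‖w + h‖) (1 + ‖h‖)`. [folklore] -/
theorem one_add_norm_le_mul {G : Type*} [SeminormedAddCommGroup G] (w h : G) :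
    1 + ‖w‖ ≤ (1 + ‖w + h‖) * (1 + ‖h‖) := by
  have h1 : ‖w‖ ≤ ‖w + h‖ + ‖h‖ := by
    calc ‖w‖ = ‖(w + h) - h‖ := by rw [add_sub_cancel_right]
      _ ≤ ‖w + h‖ + ‖h‖ := norm_sub_le _ _
  nlinarith [norm_nonneg (w + h), norm_nonneg h, mul_nonneg (norm_nonneg (w + h)) (norm_nonneg h)]

omit [FiniteDimensional ℝ E] [MeasurableSpace E] [BorelSpace E] in
/-- A Schwartz function is dominated, uniformly over translations `‖h‖ ≤ ρ`, by an integrable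
multiple of `(1 + ‖w‖)^{-(d+1)}`: `‖θ(w + h)‖ ≤ C (1 + ρ)^{d+1} (1 + ‖w‖)^{-(d+1)}`. [folklore] -/
theorem schwartz_exists_norm_comp_add_le {F : Type*} [NormedAddCommGroup F] [NormedSpace ℝ F]
    (θ : 𝓢(E, F)) :
    ∃ C : ℝ, 0 ≤ C ∧ ∀ (ρ : ℝ), 0 ≤ ρ → ∀ h : E, ‖h‖ ≤ ρ → ∀ w : E,
      ‖θ (w + h)‖ ≤ C * (1 + ρ) ^ (Module.finrank ℝ E + 1) *
        (1 + ‖w‖) ^ (-((Module.finrank ℝ E : ℝ) + 1)) := by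
  set d : ℕ := Module.finrank ℝ E with hd
  set C : ℝ := 2 ^ (d + 1) *
    (Finset.Iic (d + 1, 0)).sup (fun m => SchwartzMap.seminorm ℝ m.1 m.2) θ with hC
  have hC0 : 0 ≤ C := by positivity
  have hdec : ∀ x : E, (1 + ‖x‖) ^ (d + 1) * ‖θ x‖ ≤ C := fun x => by
    have h := SchwartzMap.one_add_le_sup_seminorm_apply (𝕜 := ℝ) (m := (d + 1, 0)) (k := d + 1)
      (n := 0) le_rfl le_rfl θ x
    rwa [norm_iteratedFDeriv_zero] at h
  refine ⟨C, hC0, fun ρ hρ h hh w => ?_⟩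
  have hP := one_add_norm_le_mul w h
  have hw0 : 0 < 1 + ‖w‖ := by positivity
  have hwh0 : 0 < 1 + ‖w + h‖ := by positivity
  -- `‖θ(w+h)‖ ≤ C (1 + ‖w + h‖)^{-(d+1)} ≤ C (1+ρ)^{d+1} (1 + ‖w‖)^{-(d+1)}`
  have h1 : ‖θ (w + h)‖ ≤ C * ((1 + ‖w + h‖) ^ (d + 1))⁻¹ := by
    rw [le_mul_inv_iff₀ (pow_pos hwh0 _), mul_comm]
    exact hdec (w + h)
  have h2 : ((1 + ‖w + h‖) ^ (d + 1))⁻¹ ≤ (1 + ρ) ^ (d + 1) * ((1 + ‖w‖) ^ (d + 1))⁻¹ := by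
    rw [inv_le_iff_one_le_mul₀ (pow_pos hwh0 _)]
    calc (1 : ℝ) = ((1 + ‖w‖) ^ (d + 1))⁻¹ * (1 + ‖w‖) ^ (d + 1) := by
          rw [inv_mul_cancel₀ (pow_ne_zero _ hw0.ne')]
      _ ≤ ((1 + ‖w‖) ^ (d + 1))⁻¹ * ((1 + ‖w + h‖) * (1 + ‖h‖)) ^ (d + 1) := by
          gcongr
      _ ≤ ((1 + ‖w‖) ^ (d + 1))⁻¹ * ((1 + ‖w + h‖) * (1 + ρ)) ^ (d + 1) := by
          gcongr
      _ = (1 + ρ) ^ (d + 1) * ((1 + ‖w‖) ^ (d + 1))⁻¹ * (1 + ‖w + h‖) ^ (d + 1) := by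
          rw [mul_pow]; ring
  have h3 : ((1 + ‖w‖) ^ (d + 1))⁻¹ = (1 + ‖w‖) ^ (-((d : ℝ) + 1)) := by
    rw [Real.rpow_neg hw0.le, ← Real.rpow_natCast, Nat.cast_add, Nat.cast_one]
  calc ‖θ (w + h)‖ ≤ C * ((1 + ‖w + h‖) ^ (d + 1))⁻¹ := h1
    _ ≤ C * ((1 + ρ) ^ (d + 1) * ((1 + ‖w‖) ^ (d + 1))⁻¹) := mul_le_mul_of_nonneg_left h2 hC0
    _ = C * (1 + ρ) ^ (d + 1) * (1 + ‖w‖) ^ (-((d : ℝ) + 1)) := by rw [h3]; ring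

/-- **Continuity of translation in `L¹` for Schwartz functions**: the translation modulus
`h ↦ ∫ ‖θ(w + h) - θ(w)‖ dw` is continuous (dominated convergence under the Schwartz decay). [folklore] -/
theorem schwartz_continuous_translationModulus {F : Type*} [NormedAddCommGroup F]
    [NormedSpace ℝ F] (θ : 𝓢(E, F)) :
    Continuous (translationModulus (θ : E → F)) := by
  set d : ℕ := Module.finrank ℝ E with hd
  obtain ⟨C, hC0, hdom⟩ := schwartz_exists_norm_comp_add_le θ
  have hint : Integrable (fun w : E => (1 + ‖w‖) ^ (-((d : ℝ) + 1))) :=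
    integrable_one_add_norm (by rw [hd]; linarith)
  refine continuous_iff_continuousAt.2 fun h₀ => ?_
  unfold translationModulus
  -- dominated convergence on the ball `‖h - h₀‖ < 1`, where `‖h‖ ≤ ‖h₀‖ + 1`
  set ρ : ℝ := ‖h₀‖ + 1 with hρ
  have hρ0 : 0 ≤ ρ := by positivity
  set bound : E → ℝ := fun w =>
    (C * (1 + ρ) ^ (d + 1) + C * (1 + 0) ^ (d + 1)) * (1 + ‖w‖) ^ (-((d : ℝ) + 1)) with hbound
  refine continuousAt_of_dominated (bound := bound) ?_ ?_ (hint.const_mul _) ?_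
  · exact Eventually.of_forall fun h =>
      ((θ.continuous.comp (continuous_id.add continuous_const)).sub θ.continuous).norm
        |>.aestronglyMeasurable
  · have hball : ∀ᶠ h in 𝓝 h₀, ‖h‖ ≤ ρ := by
      filter_upwards [Metric.ball_mem_nhds h₀ one_pos] with h hh
      rw [Metric.mem_ball, dist_eq_norm] at hh
      calc ‖h‖ = ‖(h - h₀) + h₀‖ := by rw [sub_add_cancel]
        _ ≤ ‖h - h₀‖ + ‖h₀‖ := norm_add_le _ _
        _ ≤ ρ := by rw [hρ]; linarith
    filter_upwards [hball] with h hh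
    refine Eventually.of_forall fun w => ?_
    rw [Real.norm_of_nonneg (norm_nonneg _)]
    calc ‖θ (w + h) - θ w‖ ≤ ‖θ (w + h)‖ + ‖θ w‖ := norm_sub_le _ _
      _ ≤ C * (1 + ρ) ^ (d + 1) * (1 + ‖w‖) ^ (-((d : ℝ) + 1)) +
            C * (1 + 0) ^ (d + 1) * (1 + ‖w‖) ^ (-((d : ℝ) + 1)) := by
          gcongr
          · exact hdom ρ hρ0 h hh w
          · simpa using hdom 0 le_rfl 0 (by simp) w
      _ = bound w := by rw [hbound]; ring
  · refine Eventually.of_forall fun w => ?_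
    exact ((θ.continuous.comp (continuous_const.add continuous_id)).sub continuous_const).norm
      |>.continuousAt

/-- The translation modulus of a Schwartz function tends to `0` with the translation. [folklore] -/
theorem schwartz_tendsto_translationModulus_zero {F : Type*} [NormedAddCommGroup F]
    [NormedSpace ℝ F] (θ : 𝓢(E, F)) :
    Tendsto (translationModulus (θ : E → F)) (𝓝 0) (𝓝 0) := by
  have h := (schwartz_continuous_translationModulus θ).tendsto 0
  have h0 : translationModulus (θ : E → F) 0 = 0 := by simp [translationModulus]
  rwa [h0] at h

end TestSide

/-! ## The kernels `η_j = 𝓕 χ(2^{-j} ·)` of the adjoint cut-offs and their dyadic scaling -/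

section DyadicKernel

variable (E : Type*) [NormedAddCommGroup E] [InnerProductSpace ℝ E] [FiniteDimensional ℝ E]
  [MeasurableSpace E] [BorelSpace E]

/-- The kernel `η_j = 𝓕 (χ(2^{-j} ·)) ∈ 𝓢(E, ℂ)` through which the low-frequency cut-off acts on
test functions: `⟨Ṡ_j T, φ⟩ = ⟨T, φ ⋆ η_j⟩` (`fourier_smulLeftCLM_fourierInv_apply_eq_integral`;
BCD (2.5) and §1.2). This is the *test-side* kernel (forward transform); the tree's
`FunctionSpaces.lowFreqZeroKernel = 𝓕⁻¹ χ` (`LittlewoodPaleyDifferenceProofs.lean`) is the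
kernel of `Ṡ₀` acting on `L^p` functions, and agrees with `η₀` only through the evenness of
`χ`, which is not used here. [folklore] -/
def lowFreqFourierKernel (j : ℤ) : 𝓢(E, ℂ) :=
  𝓕 (FunctionSpaces.lowFreqSymbolSchwartz E j)

variable {E}

omit [FiniteDimensional ℝ E] [MeasurableSpace E] [BorelSpace E] in
/-- `χ(2^{-j} ξ) = χ₀(2^{-j} ξ)` with `χ₀ = χ(2^{-0} ·)`: the symbols are dilates of one another. [folklore] -/
theorem lowFreqSymbol_eq_comp_smul (j : ℤ) :
    FunctionSpaces.lowFreqSymbol (E := E) j =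
      fun ξ => FunctionSpaces.lowFreqSymbol (E := E) 0 (((2 : ℝ) ^ (-j)) • ξ) := by
  funext ξ
  simp [FunctionSpaces.lowFreqSymbol]

/-- **Dyadic scaling of the kernels**: `η_j(x) = 2^{jd} η₀(2^j x)` (Fourier transform of a
dilation). [folklore] -/
theorem lowFreqFourierKernel_apply (j : ℤ) (x : E) :
    lowFreqFourierKernel E j x =
      ((((2 : ℝ) ^ j) ^ Module.finrank ℝ E : ℝ)) • lowFreqFourierKernel E 0 (((2 : ℝ) ^ j) • x) := by
  have h2 : (2 : ℝ) ^ (-j) ≠ 0 := zpow_ne_zero _ two_ne_zero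
  simp only [lowFreqFourierKernel, SchwartzMap.fourier_coe, FunctionSpaces.coe_lowFreqSymbolSchwartz]
  rw [lowFreqSymbol_eq_comp_smul j, FunctionSpaces.fourier_comp_smul _ h2]
  congr 1
  · rw [zpow_neg, inv_pow, inv_inv, abs_of_pos (by positivity)]
  · rw [zpow_neg, inv_inv]

/-- **Dyadic scaling of the translation moduli**: `Ω_{η_j}(z) = Ω_{η₀}(2^j z)` (change of
variables `w ↦ 2^j w`). [folklore] -/
theorem translationModulus_lowFreqFourierKernel (j : ℤ) (z : E) :
    translationModulus (lowFreqFourierKernel E j) z =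
      translationModulus (lowFreqFourierKernel E 0) (((2 : ℝ) ^ j) • z) := by
  set c : ℝ := (2 : ℝ) ^ j with hc
  have hc0 : 0 < c := by positivity
  set d : ℕ := Module.finrank ℝ E with hd
  unfold translationModulus
  have hpt : ∀ w : E, ‖lowFreqFourierKernel E j (w + z) - lowFreqFourierKernel E j w‖ =
      (fun y : E => c ^ d * ‖lowFreqFourierKernel E 0 (y + c • z) - lowFreqFourierKernel E 0 y‖)
        (c • w) := by
    intro w
    simp only [lowFreqFourierKernel_apply j, ← hc, smul_add, ← smul_sub, norm_smul,
      Real.norm_of_nonneg (pow_nonneg hc0.le _), hd]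
  simp_rw [hpt]
  rw [Measure.integral_comp_smul (volume : Measure E)
    (fun y : E => c ^ d * ‖lowFreqFourierKernel E 0 (y + c • z) - lowFreqFourierKernel E 0 y‖) c,
    integral_const_mul, smul_eq_mul, ← mul_assoc, abs_of_pos (by positivity), hd,
    inv_mul_cancel₀ (pow_ne_zero _ hc0.ne'), one_mul]

/-- `Ω_{η_j}(z) ≤ 2 ‖η₀‖_{L¹}` uniformly in `j` and `z`. [folklore] -/
theorem translationModulus_lowFreqFourierKernel_le (j : ℤ) (z : E) :
    translationModulus (lowFreqFourierKernel E j) z ≤ 2 * ∫ w, ‖lowFreqFourierKernel E 0 w‖ := by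
  rw [translationModulus_lowFreqFourierKernel]
  exact translationModulus_le (lowFreqFourierKernel E 0).integrable _

/-- **The translation moduli of the kernels vanish in the large-scale limit**:
`Ω_{η_j}(z) → 0` as `j → -∞`, for every fixed `z`. [folklore] -/
theorem tendsto_translationModulus_lowFreqFourierKernel_atBot (z : E) :
    Tendsto (fun j : ℤ => translationModulus (lowFreqFourierKernel E j) z) atBot (𝓝 0) := by
  have e : (fun j : ℤ => translationModulus (lowFreqFourierKernel E j) z) =
      fun j : ℤ => translationModulus (lowFreqFourierKernel E 0) (((2 : ℝ) ^ j) • z) :=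
    funext fun j => translationModulus_lowFreqFourierKernel j z
  rw [e]
  have h : Tendsto (fun j : ℤ => ((2 : ℝ) ^ j) • z) atBot (𝓝 0) := by
    simpa using FunctionSpaces.tendsto_two_zpow_atBot.smul_const z
  exact (schwartz_tendsto_translationModulus_zero (lowFreqFourierKernel E 0)).comp h

/-- **The adjoint cut-off of a test function is a convolution with `η_j`**:
`𝓕 (χ(2^{-j} ·) 𝓕⁻¹ φ)(x) = ∫ φ(y) η_j(x - y) dy`. [folklore] -/
theorem fourier_lowFreqSymbol_smul_fourierInv_apply (j : ℤ) (φ : 𝓢(E, ℂ)) (x : E) :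
    (𝓕 (SchwartzMap.smulLeftCLM ℂ (FunctionSpaces.lowFreqSymbol (E := E) j) (𝓕⁻ φ))) x =
      ∫ y, φ y * lowFreqFourierKernel E j (x - y) := by
  rw [← FunctionSpaces.coe_lowFreqSymbolSchwartz,
    FunctionSpaces.fourier_smulLeftCLM_fourierInv_apply_eq_integral]
  rfl

end DyadicKernel

/-! ## The parabolic majorant of the Oseen kernel -/

section MajorantBasic

variable (E : Type*) [NormedAddCommGroup E] [InnerProductSpace ℝ E]

/-- A constant `C = C(E) > 0` in Koch–Tataru's kernel bound (14),
`‖K(τ, z)[a, b]‖ ≤ C (τ + ‖z‖²)^{-(d+1)/2} ‖a‖ ‖b‖` (`exists_norm_oseenKernel_le`), fixed once and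
for all. [cite: KochTataruAdvMath2001, §3 (14)] -/
def oseenKernelBoundConst : ℝ :=
  (exists_norm_oseenKernel_le (E := E)).choose

/-- The **parabolic majorant** `k(σ, z) = C (σ + ‖z‖²)^{-(d+1)/2}` of the Oseen–Koch–Tataru kernel
(Koch–Tataru 2001, (14)). [cite: KochTataruAdvMath2001, §3 (14)] -/
def oseenMajorant (σ : ℝ) (z : E) : ℝ :=
  oseenKernelBoundConst E * (σ + ‖z‖ ^ 2) ^ (-(((Module.finrank ℝ E : ℝ) + 1) / 2))

variable {E}

/-- The kernel constant is positive. [folklore] -/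
theorem oseenKernelBoundConst_pos : 0 < oseenKernelBoundConst E :=
  (exists_norm_oseenKernel_le (E := E)).choose_spec.1

/-- Koch–Tataru's bound (14) with the fixed constant: `‖K(τ, z)[a, b]‖ ≤ k(τ, z) ‖a‖ ‖b‖`. [cite: KochTataruAdvMath2001, §3 (14)] -/
theorem norm_oseenKernel_le_oseenMajorant {τ : ℝ} (hτ : 0 < τ) (z a b : E) :
    ‖oseenKernel τ z a b‖ ≤ oseenMajorant E τ z * ‖a‖ * ‖b‖ :=
  (exists_norm_oseenKernel_le (E := E)).choose_spec.2 hτ z a b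

/-- The bound (14) against constants: `‖K(τ, z)[a, b]‖ ≤ M_a M_b k(τ, z)` when `‖a‖ ≤ M_a`,
`‖b‖ ≤ M_b`. [cite: KochTataruAdvMath2001, §3 (14)] -/
theorem norm_oseenKernel_le_mul_oseenMajorant {τ : ℝ} (hτ : 0 < τ) (z : E) {a b : E} {Ma Mb : ℝ}
    (ha : ‖a‖ ≤ Ma) (hb : ‖b‖ ≤ Mb) (hMa : 0 ≤ Ma) :
    ‖oseenKernel τ z a b‖ ≤ Ma * Mb * oseenMajorant E τ z := by
  have h0 : 0 ≤ oseenMajorant E τ z :=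
    mul_nonneg oseenKernelBoundConst_pos.le (Real.rpow_nonneg (by positivity) _)
  calc ‖oseenKernel τ z a b‖ ≤ oseenMajorant E τ z * ‖a‖ * ‖b‖ :=
        norm_oseenKernel_le_oseenMajorant hτ z a b
    _ ≤ oseenMajorant E τ z * Ma * Mb :=
        mul_le_mul (mul_le_mul_of_nonneg_left ha h0) hb (norm_nonneg _) (mul_nonneg h0 hMa)
    _ = Ma * Mb * oseenMajorant E τ z := by ring

/-- The majorant is nonnegative (`σ ≥ 0`). [folklore] -/
theorem oseenMajorant_nonneg {σ : ℝ} (hσ : 0 ≤ σ) (z : E) : 0 ≤ oseenMajorant E σ z :=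
  mul_nonneg oseenKernelBoundConst_pos.le (Real.rpow_nonneg (by positivity) _)

/-- The majorant is even: `k(σ, x - y) = k(σ, y - x)`. [folklore] -/
theorem oseenMajorant_sub_comm (σ : ℝ) (x y : E) :
    oseenMajorant E σ (x - y) = oseenMajorant E σ (y - x) := by
  simp only [oseenMajorant, norm_sub_rev x y]

end MajorantBasic

section MajorantMeasurable

variable {E : Type*} [NormedAddCommGroup E] [InnerProductSpace ℝ E] [MeasurableSpace E]
  [BorelSpace E]

/-- The majorant is jointly measurable in `(σ, z)`. [folklore] -/
theorem measurable_oseenMajorant_uncurry :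
    Measurable (fun q : ℝ × E => oseenMajorant E q.1 q.2) := by
  unfold oseenMajorant
  exact ((measurable_fst.add (measurable_snd.norm.pow_const 2)).pow_const _).const_mul _

end MajorantMeasurable

section MajorantIntegral

variable (E : Type*) [NormedAddCommGroup E] [InnerProductSpace ℝ E] [FiniteDimensional ℝ E]
  [MeasurableSpace E] [BorelSpace E]

/-- The mass constant `m = C ∫ (1 + ‖w‖²)^{-(d+1)/2} dw` of the majorant: `∫ k(σ, z) dz = m σ^{-1/2}`
(`integral_oseenMajorant`). [folklore] -/
def oseenMajorantMass : ℝ :=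
  oseenKernelBoundConst E * ∫ w : E, (1 + ‖w‖ ^ 2) ^ (-(((Module.finrank ℝ E : ℝ) + 1) / 2))

variable {E}

/-- The mass constant is positive. [folklore] -/
theorem oseenMajorantMass_pos : 0 < oseenMajorantMass E := by
  have he : (Module.finrank ℝ E : ℝ) < 2 * (((Module.finrank ℝ E : ℝ) + 1) / 2) := by linarith
  exact mul_pos oseenKernelBoundConst_pos (integral_one_add_norm_sq_rpow_neg_pos he)

/-- The majorant is integrable in `z` for `σ > 0`. [folklore] -/
theorem integrable_oseenMajorant {σ : ℝ} (hσ : 0 < σ) : Integrable (oseenMajorant E σ) := by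
  have he : (Module.finrank ℝ E : ℝ) < 2 * (((Module.finrank ℝ E : ℝ) + 1) / 2) := by linarith
  exact (integrable_add_norm_sq_rpow_neg he hσ).const_mul _

/-- **Parabolic scaling of the majorant**: `∫ k(σ, z) dz = m σ^{-1/2}`. [folklore] -/
theorem integral_oseenMajorant {σ : ℝ} (hσ : 0 < σ) :
    ∫ z, oseenMajorant E σ z = oseenMajorantMass E * σ ^ (-(1 / 2 : ℝ)) := by
  unfold oseenMajorant oseenMajorantMass
  rw [integral_const_mul, integral_add_norm_sq_rpow_neg hσ]
  have h : (Module.finrank ℝ E : ℝ) / 2 - ((Module.finrank ℝ E : ℝ) + 1) / 2 = -(1 / 2 : ℝ) := by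
    ring
  rw [h]; ring

/-- `∫⁻ k(σ, z) dz = m σ^{-1/2}` in `ℝ≥0∞`. [folklore] -/
theorem lintegral_oseenMajorant {σ : ℝ} (hσ : 0 < σ) :
    ∫⁻ z, ENNReal.ofReal (oseenMajorant E σ z) =
      ENNReal.ofReal (oseenMajorantMass E * σ ^ (-(1 / 2 : ℝ))) := by
  rw [← integral_oseenMajorant hσ, ofReal_integral_eq_lintegral_ofReal (integrable_oseenMajorant hσ)
    (Eventually.of_forall fun z => oseenMajorant_nonneg hσ.le z)]

end MajorantIntegral

/-- **The viscous time weight is integrable**: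
`∫⁻_{(s,t)} (ν(t - τ))^{-1/2} dτ = ν^{-1/2} · 2 (t - s)^{1/2}` (`s ≤ t`, `ν > 0`). [folklore] -/
theorem lintegral_Ioo_viscousWeight {ν s t : ℝ} (hν : 0 < ν) (hst : s ≤ t) :
    ∫⁻ τ in Ioo s t, ENNReal.ofReal ((ν * (t - τ)) ^ (-(1 / 2 : ℝ))) =
      ENNReal.ofReal (ν ^ (-(1 / 2 : ℝ)) * (2 * (t - s) ^ (1 / 2 : ℝ))) := by
  have h1 : ∫⁻ τ in Ioo s t, ENNReal.ofReal ((ν * (t - τ)) ^ (-(1 / 2 : ℝ))) =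
      ∫⁻ τ in Ioc (t - (t - s)) t, ENNReal.ofReal (ν ^ (-(1 / 2 : ℝ))) *
        ENNReal.ofReal ((t - τ) ^ (-(1 / 2 : ℝ))) := by
    rw [sub_sub_cancel, ← restrict_Ioo_eq_restrict_Ioc]
    refine setLIntegral_congr_fun measurableSet_Ioo fun τ hτ => ?_
    rw [Real.mul_rpow hν.le (by linarith [hτ.2]), ENNReal.ofReal_mul (Real.rpow_nonneg hν.le _)]
  rw [h1, lintegral_const_mul' _ _ ENNReal.ofReal_ne_top,
    FujitaKato.lintegral_Ioc_sub_rpow (by norm_num) (sub_nonneg.2 hst),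
    ← ENNReal.ofReal_mul (Real.rpow_nonneg hν.le _)]
  congr 1
  have h2 : (-(1 / 2 : ℝ)) + 1 = 1 / 2 := by norm_num
  rw [h2]
  ring

/-! ## The Duhamel integrand of bounded fields: integrability, representation, bounds -/

section Fields

variable {ι : Type*} [Fintype ι]

variable {ν s t Mu Mv : ℝ} {u v : ℝ → EuclideanSpace ℝ ι → EuclideanSpace ℝ ι}

/-- The Duhamel integrand `(τ, y) ↦ K(ν(t-τ), x-y)[u(τ,y), v(τ,y)]` is measurable on
`(s, t) × E` for jointly measurable fields. [folklore] -/
theorem aestronglyMeasurable_oseenKernel_fields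
    (hu : AEStronglyMeasurable (uncurry u) (volume.restrict (Ioo s t ×ˢ univ)))
    (hv : AEStronglyMeasurable (uncurry v) (volume.restrict (Ioo s t ×ˢ univ)))
    (x : EuclideanSpace ℝ ι) :
    AEStronglyMeasurable
      (fun p : ℝ × EuclideanSpace ℝ ι =>
        oseenKernel (ν * (t - p.1)) (x - p.2) (u p.1 p.2) (v p.1 p.2))
      ((volume.restrict (Ioo s t)).prod (volume : Measure (EuclideanSpace ℝ ι))) := by
  rw [← volume_restrict_prod_univ_eq_prod]
  have ha : AEMeasurable (fun p : ℝ × EuclideanSpace ℝ ι => ν * (t - p.1))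
      ((volume : Measure (ℝ × EuclideanSpace ℝ ι)).restrict (Ioo s t ×ˢ univ)) :=
    (measurable_const.mul (measurable_const.sub measurable_fst)).aemeasurable
  have hb : AEMeasurable (fun p : ℝ × EuclideanSpace ℝ ι => x - p.2)
      ((volume : Measure (ℝ × EuclideanSpace ℝ ι)).restrict (Ioo s t ×ˢ univ)) :=
    (measurable_const.sub measurable_snd).aemeasurable
  exact (AEMeasurable.oseenKernel_comp ha hb hu.aemeasurable hv.aemeasurable).aestronglyMeasurable

/-- The Duhamel integrand is jointly measurable in `(x, (τ, y))`. [folklore] -/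
theorem aestronglyMeasurable_oseenKernel_fields_prod
    (hu : AEStronglyMeasurable (uncurry u) (volume.restrict (Ioo s t ×ˢ univ)))
    (hv : AEStronglyMeasurable (uncurry v) (volume.restrict (Ioo s t ×ˢ univ))) :
    AEStronglyMeasurable
      (fun q : EuclideanSpace ℝ ι × (ℝ × EuclideanSpace ℝ ι) =>
        oseenKernel (ν * (t - q.2.1)) (q.1 - q.2.2) (u q.2.1 q.2.2) (v q.2.1 q.2.2))
      ((volume : Measure (EuclideanSpace ℝ ι)).prod
        ((volume.restrict (Ioo s t)).prod (volume : Measure (EuclideanSpace ℝ ι)))) := by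
  rw [← volume_restrict_prod_univ_eq_prod]
  have hu' : AEMeasurable (fun q : EuclideanSpace ℝ ι × (ℝ × EuclideanSpace ℝ ι) => uncurry u q.2)
      ((volume : Measure (EuclideanSpace ℝ ι)).prod
        ((volume : Measure (ℝ × EuclideanSpace ℝ ι)).restrict (Ioo s t ×ˢ univ))) :=
    hu.aemeasurable.comp_snd
  have hv' : AEMeasurable (fun q : EuclideanSpace ℝ ι × (ℝ × EuclideanSpace ℝ ι) => uncurry v q.2)
      ((volume : Measure (EuclideanSpace ℝ ι)).prod
        ((volume : Measure (ℝ × EuclideanSpace ℝ ι)).restrict (Ioo s t ×ˢ univ))) :=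
    hv.aemeasurable.comp_snd
  have ha : AEMeasurable (fun q : EuclideanSpace ℝ ι × (ℝ × EuclideanSpace ℝ ι) => ν * (t - q.2.1))
      ((volume : Measure (EuclideanSpace ℝ ι)).prod
        ((volume : Measure (ℝ × EuclideanSpace ℝ ι)).restrict (Ioo s t ×ˢ univ))) :=
    (measurable_const.mul (measurable_const.sub (measurable_fst.comp measurable_snd))).aemeasurable
  have hb : AEMeasurable (fun q : EuclideanSpace ℝ ι × (ℝ × EuclideanSpace ℝ ι) => q.1 - q.2.2)
      ((volume : Measure (EuclideanSpace ℝ ι)).prod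
        ((volume : Measure (ℝ × EuclideanSpace ℝ ι)).restrict (Ioo s t ×ˢ univ))) :=
    (measurable_fst.sub (measurable_snd.comp measurable_snd)).aemeasurable
  exact (AEMeasurable.oseenKernel_comp ha hb hu' hv').aestronglyMeasurable

/-- **Slice bound**: for `s < τ < t`,
`∫⁻ ‖K(ν(t-τ), x-y)[u(τ,y), v(τ,y)]‖ dy ≤ M_u M_v m (ν(t-τ))^{-1/2}`. [folklore] -/
theorem lintegral_enorm_oseenKernel_slice_le (hν : 0 < ν)
    (huM : ∀ τ ∈ Ioo s t, ∀ y, ‖u τ y‖ ≤ Mu) (hvM : ∀ τ ∈ Ioo s t, ∀ y, ‖v τ y‖ ≤ Mv)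
    (hMu : 0 ≤ Mu) (hMv : 0 ≤ Mv) {τ : ℝ} (hτ : τ ∈ Ioo s t) (x : EuclideanSpace ℝ ι) :
    ∫⁻ y, ‖oseenKernel (ν * (t - τ)) (x - y) (u τ y) (v τ y)‖ₑ ≤
      ENNReal.ofReal (Mu * Mv * (oseenMajorantMass (EuclideanSpace ℝ ι) *
        (ν * (t - τ)) ^ (-(1 / 2 : ℝ)))) := by
  have hσ : 0 < ν * (t - τ) := mul_pos hν (sub_pos.2 hτ.2)
  have hMM : 0 ≤ Mu * Mv := mul_nonneg hMu hMv
  calc ∫⁻ y, ‖oseenKernel (ν * (t - τ)) (x - y) (u τ y) (v τ y)‖ₑ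
      ≤ ∫⁻ y, ENNReal.ofReal (Mu * Mv) *
          ENNReal.ofReal (oseenMajorant (EuclideanSpace ℝ ι) (ν * (t - τ)) (y - x)) := by
        refine lintegral_mono fun y => ?_
        rw [← ofReal_norm, ← ENNReal.ofReal_mul hMM, ← oseenMajorant_sub_comm]
        exact ENNReal.ofReal_le_ofReal
          (norm_oseenKernel_le_mul_oseenMajorant hσ _ (huM τ hτ y) (hvM τ hτ y) hMu)
    _ = ENNReal.ofReal (Mu * Mv) *
          ∫⁻ y, ENNReal.ofReal (oseenMajorant (EuclideanSpace ℝ ι) (ν * (t - τ)) y) := by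
        rw [lintegral_const_mul' _ _ ENNReal.ofReal_ne_top,
          lintegral_sub_right_eq_self
            (fun y => ENNReal.ofReal (oseenMajorant (EuclideanSpace ℝ ι) (ν * (t - τ)) y)) x]
    _ = ENNReal.ofReal (Mu * Mv * (oseenMajorantMass (EuclideanSpace ℝ ι) *
          (ν * (t - τ)) ^ (-(1 / 2 : ℝ)))) := by
        rw [lintegral_oseenMajorant hσ, ← ENNReal.ofReal_mul hMM]

/-- **Absolute convergence of the Duhamel integral of bounded fields**, quantitatively:
`∫⁻_{(s,t) × E} ‖K(ν(t-τ), x-y)[u, v]‖ ≤ M_u M_v m ν^{-1/2} 2 (t-s)^{1/2}`, uniformly in `x`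
(KNSS 2009, §4 p. 8, the estimate `‖B(u,v)‖ ≤ C√T ‖u‖ ‖v‖`). [cite: KochNadirashviliSereginSverak2009, §4 p. 8 (arXiv:0709.3599)] -/
theorem lintegral_enorm_oseenKernel_fields_le (hν : 0 < ν) (hst : s ≤ t)
    (hu : AEStronglyMeasurable (uncurry u) (volume.restrict (Ioo s t ×ˢ univ)))
    (hv : AEStronglyMeasurable (uncurry v) (volume.restrict (Ioo s t ×ˢ univ)))
    (huM : ∀ τ ∈ Ioo s t, ∀ y, ‖u τ y‖ ≤ Mu) (hvM : ∀ τ ∈ Ioo s t, ∀ y, ‖v τ y‖ ≤ Mv)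
    (hMu : 0 ≤ Mu) (hMv : 0 ≤ Mv) (x : EuclideanSpace ℝ ι) :
    ∫⁻ p, ‖oseenKernel (ν * (t - p.1)) (x - p.2) (u p.1 p.2) (v p.1 p.2)‖ₑ
        ∂((volume.restrict (Ioo s t)).prod (volume : Measure (EuclideanSpace ℝ ι))) ≤
      ENNReal.ofReal (Mu * Mv * oseenMajorantMass (EuclideanSpace ℝ ι) *
        (ν ^ (-(1 / 2 : ℝ)) * (2 * (t - s) ^ (1 / 2 : ℝ)))) := by
  have hMMm : 0 ≤ Mu * Mv * oseenMajorantMass (EuclideanSpace ℝ ι) :=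
    mul_nonneg (mul_nonneg hMu hMv) oseenMajorantMass_pos.le
  rw [lintegral_prod _ (aestronglyMeasurable_oseenKernel_fields hu hv x).aemeasurable.enorm]
  calc ∫⁻ τ in Ioo s t, ∫⁻ y, ‖oseenKernel (ν * (t - τ)) (x - y) (u τ y) (v τ y)‖ₑ
      ≤ ∫⁻ τ in Ioo s t, ENNReal.ofReal (Mu * Mv * oseenMajorantMass (EuclideanSpace ℝ ι)) *
          ENNReal.ofReal ((ν * (t - τ)) ^ (-(1 / 2 : ℝ))) := by
        refine setLIntegral_mono' measurableSet_Ioo fun τ hτ => ?_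
        rw [← ENNReal.ofReal_mul hMMm, mul_assoc]
        exact lintegral_enorm_oseenKernel_slice_le hν huM hvM hMu hMv hτ x
    _ = ENNReal.ofReal (Mu * Mv * oseenMajorantMass (EuclideanSpace ℝ ι) *
          (ν ^ (-(1 / 2 : ℝ)) * (2 * (t - s) ^ (1 / 2 : ℝ)))) := by
        rw [lintegral_const_mul' _ _ ENNReal.ofReal_ne_top, lintegral_Ioo_viscousWeight hν hst,
          ← ENNReal.ofReal_mul hMMm]

/-- The Duhamel integrand of bounded fields is integrable on `(s, t) × E`, at every `x`. [folklore] -/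
theorem integrable_oseenKernel_fields (hν : 0 < ν) (hst : s ≤ t)
    (hu : AEStronglyMeasurable (uncurry u) (volume.restrict (Ioo s t ×ˢ univ)))
    (hv : AEStronglyMeasurable (uncurry v) (volume.restrict (Ioo s t ×ˢ univ)))
    (huM : ∀ τ ∈ Ioo s t, ∀ y, ‖u τ y‖ ≤ Mu) (hvM : ∀ τ ∈ Ioo s t, ∀ y, ‖v τ y‖ ≤ Mv)
    (hMu : 0 ≤ Mu) (hMv : 0 ≤ Mv) (x : EuclideanSpace ℝ ι) :
    Integrable
      (fun p : ℝ × EuclideanSpace ℝ ι =>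
        oseenKernel (ν * (t - p.1)) (x - p.2) (u p.1 p.2) (v p.1 p.2))
      ((volume.restrict (Ioo s t)).prod (volume : Measure (EuclideanSpace ℝ ι))) :=
  ⟨aestronglyMeasurable_oseenKernel_fields hu hv x,
    (lintegral_enorm_oseenKernel_fields_le hν hst hu hv huM hvM hMu hMv x).trans_lt
      ENNReal.ofReal_lt_top⟩

/-- **The Duhamel term as one absolutely convergent integral over `(s, t) × E`** (Fubini):
`B^ν_s(u, v)(t)(x) = ∫_{(s,t) × E} K(ν(t-τ), x-y)[u(τ,y), v(τ,y)] d(τ,y)`. [folklore] -/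
theorem oseenDuhamel_eq_integral_prod_of_bound (hν : 0 < ν) (hst : s ≤ t)
    (hu : AEStronglyMeasurable (uncurry u) (volume.restrict (Ioo s t ×ˢ univ)))
    (hv : AEStronglyMeasurable (uncurry v) (volume.restrict (Ioo s t ×ˢ univ)))
    (huM : ∀ τ ∈ Ioo s t, ∀ y, ‖u τ y‖ ≤ Mu) (hvM : ∀ τ ∈ Ioo s t, ∀ y, ‖v τ y‖ ≤ Mv)
    (hMu : 0 ≤ Mu) (hMv : 0 ≤ Mv) (x : EuclideanSpace ℝ ι) :
    oseenDuhamel ν s u v t x =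
      ∫ p, oseenKernel (ν * (t - p.1)) (x - p.2) (u p.1 p.2) (v p.1 p.2)
        ∂((volume.restrict (Ioo s t)).prod (volume : Measure (EuclideanSpace ℝ ι))) := by
  rw [oseenDuhamel_apply,
    integral_prod _ (integrable_oseenKernel_fields hν hst hu hv huM hvM hMu hMv x)]

/-- **`L^∞` bound for the Duhamel term of bounded fields**:
`‖B^ν_s(u, v)(t)(x)‖ ≤ M_u M_v m ν^{-1/2} 2 (t-s)^{1/2}` (KNSS 2009, §4 p. 8,
`‖B(u,v)‖ ≤ C√T ‖u‖ ‖v‖`). [cite: KochNadirashviliSereginSverak2009, §4 p. 8 (arXiv:0709.3599)] -/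
theorem norm_oseenDuhamel_le_of_bound (hν : 0 < ν) (hst : s ≤ t)
    (hu : AEStronglyMeasurable (uncurry u) (volume.restrict (Ioo s t ×ˢ univ)))
    (hv : AEStronglyMeasurable (uncurry v) (volume.restrict (Ioo s t ×ˢ univ)))
    (huM : ∀ τ ∈ Ioo s t, ∀ y, ‖u τ y‖ ≤ Mu) (hvM : ∀ τ ∈ Ioo s t, ∀ y, ‖v τ y‖ ≤ Mv)
    (hMu : 0 ≤ Mu) (hMv : 0 ≤ Mv) (x : EuclideanSpace ℝ ι) :
    ‖oseenDuhamel ν s u v t x‖ ≤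
      Mu * Mv * oseenMajorantMass (EuclideanSpace ℝ ι) *
        (ν ^ (-(1 / 2 : ℝ)) * (2 * (t - s) ^ (1 / 2 : ℝ))) := by
  rw [oseenDuhamel_eq_integral_prod_of_bound hν hst hu hv huM hvM hMu hMv x]
  have h := lintegral_enorm_oseenKernel_fields_le hν hst hu hv huM hvM hMu hMv x
  have hnn : 0 ≤ Mu * Mv * oseenMajorantMass (EuclideanSpace ℝ ι) *
      (ν ^ (-(1 / 2 : ℝ)) * (2 * (t - s) ^ (1 / 2 : ℝ))) :=
    mul_nonneg (mul_nonneg (mul_nonneg hMu hMv) oseenMajorantMass_pos.le)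
      (mul_nonneg (Real.rpow_nonneg hν.le _)
        (mul_nonneg zero_le_two (Real.rpow_nonneg (sub_nonneg.2 hst) _)))
  refine (norm_integral_le_lintegral_norm _).trans ?_
  simp_rw [ofReal_norm]
  rw [← ENNReal.ofReal_le_ofReal_iff hnn,
    ENNReal.ofReal_toReal (h.trans_lt ENNReal.ofReal_lt_top).ne]
  exact h

/-- The Duhamel term of bounded measurable fields is a.e. strongly measurable in `x`. [folklore] -/
theorem aestronglyMeasurable_oseenDuhamel_of_bound (hν : 0 < ν) (hst : s ≤ t)
    (hu : AEStronglyMeasurable (uncurry u) (volume.restrict (Ioo s t ×ˢ univ)))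
    (hv : AEStronglyMeasurable (uncurry v) (volume.restrict (Ioo s t ×ˢ univ)))
    (huM : ∀ τ ∈ Ioo s t, ∀ y, ‖u τ y‖ ≤ Mu) (hvM : ∀ τ ∈ Ioo s t, ∀ y, ‖v τ y‖ ≤ Mv)
    (hMu : 0 ≤ Mu) (hMv : 0 ≤ Mv) :
    AEStronglyMeasurable (oseenDuhamel ν s u v t) (volume : Measure (EuclideanSpace ℝ ι)) := by
  have h := (aestronglyMeasurable_oseenKernel_fields_prod (ν := ν) (t := t) hu hv).integral_prod_right'
  refine h.congr (Eventually.of_forall fun x => ?_)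
  exact (oseenDuhamel_eq_integral_prod_of_bound hν hst hu hv huM hvM hMu hMv x).symm

end Fields

/-! ## Testing the Duhamel term: Fubini, cancellation, and the bound by translation moduli -/

section Tested

variable {ι : Type*} [Fintype ι]

variable {ν s t Mu Mv : ℝ} {u v : ℝ → EuclideanSpace ℝ ι → EuclideanSpace ℝ ι}

/-- The translation modulus is invariant under translating the function:
`Ω_{θ(· - y₀)} = Ω_θ`. [folklore] -/
theorem translationModulus_comp_sub_right {F : Type*} [NormedAddCommGroup F]
    (θ : EuclideanSpace ℝ ι → F) (y₀ z : EuclideanSpace ℝ ι) :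
    translationModulus (fun x => θ (x - y₀)) z = translationModulus θ z := by
  unfold translationModulus
  have h := integral_sub_right_eq_self (μ := (volume : Measure (EuclideanSpace ℝ ι)))
    (fun w => ‖θ (w + z) - θ w‖) y₀
  rw [← h]
  refine integral_congr_ae (Eventually.of_forall fun w => ?_)
  simp only [add_sub_right_comm]

/-- **Cancellation under the kernel**: for `σ > 0`,
`∫ θ(x) K(σ, x - y)[a, b] dx = ∫ (θ(z + y) - θ(y)) K(σ, z)[a, b] dz`, since `∫ K(σ, z) dz = 0`
(`integral_oseenKernel_eq_zero`); complexified values. [folklore] -/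
theorem integral_smul_complexify_oseenKernel_eq {σ : ℝ} (hσ : 0 < σ)
    {θ : EuclideanSpace ℝ ι → ℂ} (hθc : Continuous θ) (hθb : ∃ B, ∀ x, ‖θ x‖ ≤ B)
    (y a b : EuclideanSpace ℝ ι) :
    ∫ x, θ x • FunctionSpaces.EuclideanSpace.complexify (oseenKernel σ (x - y) a b) =
      ∫ z, (θ (z + y) - θ y) • FunctionSpaces.EuclideanSpace.complexify (oseenKernel σ z a b) := by
  obtain ⟨C, -, hK⟩ := exists_lintegral_enorm_oseenKernel_le (E := EuclideanSpace ℝ ι)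
  have hint : Integrable (fun z : EuclideanSpace ℝ ι => oseenKernel σ z a b) := (hK hσ a b).1
  set L := (FunctionSpaces.EuclideanSpace.complexify (ι := ι)).toContinuousLinearMap with hL
  have hLint : Integrable (fun z : EuclideanSpace ℝ ι => L (oseenKernel σ z a b)) :=
    L.integrable_comp hint
  obtain ⟨B, hB⟩ := hθb
  -- the two pieces are integrable
  have h1 : Integrable (fun z : EuclideanSpace ℝ ι => θ (z + y) • L (oseenKernel σ z a b)) :=
    hLint.bdd_smul B ((hθc.comp (continuous_id.add continuous_const)).aestronglyMeasurable)
      (Eventually.of_forall fun z => hB _)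
  have h2 : Integrable (fun z : EuclideanSpace ℝ ι => θ y • L (oseenKernel σ z a b)) :=
    Integrable.smul (θ y) hLint
  -- translate `x = z + y`
  have htr : ∫ x, θ x • L (oseenKernel σ (x - y) a b) =
      ∫ z, θ (z + y) • L (oseenKernel σ z a b) := by
    rw [← integral_add_right_eq_self (fun x => θ x • L (oseenKernel σ (x - y) a b)) y]
    simp only [add_sub_cancel_right]
  -- the constant piece vanishes
  have hzero : ∫ z, θ y • L (oseenKernel σ z a b) = 0 := by
    rw [integral_smul, L.integral_comp_comm hint, integral_oseenKernel_eq_zero σ a b, map_zero,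
      smul_zero]
  change ∫ x, θ x • L (oseenKernel σ (x - y) a b) = ∫ z, (θ (z + y) - θ y) • L (oseenKernel σ z a b)
  rw [htr]
  simp_rw [sub_smul]
  rw [integral_sub h1 h2, hzero, sub_zero]

/-- **Bound for the tested kernel**: with `‖a‖ ≤ M_a`, `‖b‖ ≤ M_b`,
`‖∫ θ(x) K(σ, x - y)[a, b] dx‖ ≤ M_a M_b ∫ ‖θ(z + y) - θ(y)‖ k(σ, z) dz`. [folklore] -/
theorem enorm_integral_smul_complexify_oseenKernel_le {σ : ℝ} (hσ : 0 < σ)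
    {θ : EuclideanSpace ℝ ι → ℂ} (hθc : Continuous θ) (hθb : ∃ B, ∀ x, ‖θ x‖ ≤ B)
    (y : EuclideanSpace ℝ ι) {a b : EuclideanSpace ℝ ι} {Ma Mb : ℝ} (ha : ‖a‖ ≤ Ma)
    (hb : ‖b‖ ≤ Mb) (hMa : 0 ≤ Ma) (hMb : 0 ≤ Mb) :
    ‖∫ x, θ x • FunctionSpaces.EuclideanSpace.complexify (oseenKernel σ (x - y) a b)‖ₑ ≤
      ENNReal.ofReal (Ma * Mb) * ∫⁻ z, ‖θ (z + y) - θ y‖ₑ *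
        ENNReal.ofReal (oseenMajorant (EuclideanSpace ℝ ι) σ z) := by
  rw [integral_smul_complexify_oseenKernel_eq hσ hθc hθb y a b, ← lintegral_const_mul' _ _
    ENNReal.ofReal_ne_top]
  refine (enorm_integral_le_lintegral_enorm _).trans (lintegral_mono fun z => ?_)
  rw [enorm_smul, mul_left_comm]
  have hK : ‖FunctionSpaces.EuclideanSpace.complexify (oseenKernel σ z a b)‖ₑ ≤
      ENNReal.ofReal (Ma * Mb) * ENNReal.ofReal (oseenMajorant (EuclideanSpace ℝ ι) σ z) := by
    rw [← ofReal_norm, FunctionSpaces.EuclideanSpace.norm_complexify,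
      ← ENNReal.ofReal_mul (mul_nonneg hMa hMb)]
    exact ENNReal.ofReal_le_ofReal (norm_oseenKernel_le_mul_oseenMajorant hσ z ha hb hMa)
  gcongr

/-- **Testing the Duhamel term and swapping the integrals** (Fubini on `E × ((s,t) × E)`, the
integrand being dominated by `‖θ(x)‖ M_u M_v k(ν(t-τ), x - y)`):
`∫ θ(x) B^ν_s(u,v)(t)(x) dx = ∫_{(s,t)×E} (∫ θ(x) K(ν(t-τ), x-y)[u(τ,y), v(τ,y)] dx) d(τ,y)`. [folklore] -/
theorem integral_smul_complexify_oseenDuhamel_eq (hν : 0 < ν) (hst : s ≤ t)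
    (hu : AEStronglyMeasurable (uncurry u) (volume.restrict (Ioo s t ×ˢ univ)))
    (hv : AEStronglyMeasurable (uncurry v) (volume.restrict (Ioo s t ×ˢ univ)))
    (huM : ∀ τ ∈ Ioo s t, ∀ y, ‖u τ y‖ ≤ Mu) (hvM : ∀ τ ∈ Ioo s t, ∀ y, ‖v τ y‖ ≤ Mv)
    (hMu : 0 ≤ Mu) (hMv : 0 ≤ Mv) {θ : EuclideanSpace ℝ ι → ℂ} (hθc : Continuous θ)
    (hθi : Integrable θ) :
    ∫ x, θ x • FunctionSpaces.EuclideanSpace.complexify (oseenDuhamel ν s u v t x) =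
      ∫ p, (∫ x, θ x • FunctionSpaces.EuclideanSpace.complexify
          (oseenKernel (ν * (t - p.1)) (x - p.2) (u p.1 p.2) (v p.1 p.2)))
        ∂((volume.restrict (Ioo s t)).prod (volume : Measure (EuclideanSpace ℝ ι))) := by
  set L := (FunctionSpaces.EuclideanSpace.complexify (ι := ι)).toContinuousLinearMap with hL
  set μ : Measure (ℝ × EuclideanSpace ℝ ι) :=
    (volume.restrict (Ioo s t)).prod (volume : Measure (EuclideanSpace ℝ ι)) with hμ
  set F : EuclideanSpace ℝ ι → ℝ × EuclideanSpace ℝ ι → EuclideanSpace ℝ ι :=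
    fun x p => oseenKernel (ν * (t - p.1)) (x - p.2) (u p.1 p.2) (v p.1 p.2) with hF
  have hFint : ∀ x, Integrable (F x) μ := fun x =>
    integrable_oseenKernel_fields hν hst hu hv huM hvM hMu hMv x
  -- Step 1: move `θ x •` and `complexify` inside the `(τ, y)`-integral
  have hstep1 : ∀ x, θ x • L (oseenDuhamel ν s u v t x) = ∫ p, θ x • L (F x p) ∂μ := by
    intro x
    rw [oseenDuhamel_eq_integral_prod_of_bound hν hst hu hv huM hvM hMu hMv x, integral_smul,
      ← L.integral_comp_comm (hFint x)]
  change ∫ x, θ x • L (oseenDuhamel ν s u v t x) = ∫ p, (∫ x, θ x • L (F x p)) ∂μ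
  simp_rw [hstep1]
  -- Step 2: Fubini; integrability of the joint integrand on `E × ((s,t) × E)`
  refine integral_integral_swap (f := fun x p => θ x • L (F x p)) ?_
  have hmeas : AEStronglyMeasurable (uncurry fun x p => θ x • L (F x p)) (volume.prod μ) := by
    have hF2 : AEStronglyMeasurable (fun q : EuclideanSpace ℝ ι × (ℝ × EuclideanSpace ℝ ι) =>
        L (F q.1 q.2)) (volume.prod μ) :=
      L.continuous.comp_aestronglyMeasurable
        (aestronglyMeasurable_oseenKernel_fields_prod (ν := ν) (t := t) hu hv)
    exact (hθc.comp_aestronglyMeasurable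
      (measurable_fst.aestronglyMeasurable (μ := volume.prod μ))).smul hF2
  refine ⟨hmeas, ?_⟩
  -- finite integral: `∫⁻ ‖θ x‖ (∫⁻ ‖F x p‖ dμ) dx ≤ ‖θ‖₁ · (uniform bound)`
  have hMMm : 0 ≤ Mu * Mv * oseenMajorantMass (EuclideanSpace ℝ ι) *
      (ν ^ (-(1 / 2 : ℝ)) * (2 * (t - s) ^ (1 / 2 : ℝ))) :=
    mul_nonneg (mul_nonneg (mul_nonneg hMu hMv) oseenMajorantMass_pos.le)
      (mul_nonneg (Real.rpow_nonneg hν.le _)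
        (mul_nonneg zero_le_two (Real.rpow_nonneg (sub_nonneg.2 hst) _)))
  set Λ : ℝ≥0∞ := ENNReal.ofReal (Mu * Mv * oseenMajorantMass (EuclideanSpace ℝ ι) *
      (ν ^ (-(1 / 2 : ℝ)) * (2 * (t - s) ^ (1 / 2 : ℝ)))) with hΛ
  have hbound : ∀ x, ∫⁻ p, ‖θ x • L (F x p)‖ₑ ∂μ ≤ ‖θ x‖ₑ * Λ := by
    intro x
    have e1 : ∀ p, ‖θ x • L (F x p)‖ₑ = ‖θ x‖ₑ * ‖F x p‖ₑ := fun p => by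
      rw [enorm_smul, ← ofReal_norm (L (F x p)), hL,
        LinearIsometry.coe_toContinuousLinearMap, FunctionSpaces.EuclideanSpace.norm_complexify,
        ofReal_norm]
    simp_rw [e1]
    rw [lintegral_const_mul' _ _ enorm_ne_top]
    gcongr
    exact lintegral_enorm_oseenKernel_fields_le hν hst hu hv huM hvM hMu hMv x
  unfold HasFiniteIntegral
  rw [lintegral_prod _ hmeas.aemeasurable.enorm]
  calc ∫⁻ x, ∫⁻ p, ‖uncurry (fun x p => θ x • L (F x p)) (x, p)‖ₑ ∂μ
      ≤ ∫⁻ x, ‖θ x‖ₑ * Λ := lintegral_mono fun x => hbound x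
    _ = (∫⁻ x, ‖θ x‖ₑ) * Λ := lintegral_mul_const' _ _ ENNReal.ofReal_ne_top
    _ < ∞ := ENNReal.mul_lt_top hθi.2 ENNReal.ofReal_lt_top

variable (ι) in
/-- The **low-frequency defect functional** of a test kernel `θ` against the Duhamel term on
`(s, t)`: `Φ(θ) = ∫_{(s,t)} ∫ k(ν(t-τ), z) Ω_θ(z) dz dτ` (in `ℝ≥0∞`), `k` the parabolic majorant
of the Oseen kernel and `Ω_θ` the `L¹` translation modulus. It controls every large-scale mean of
`B^ν_s(u, v)(t)` taken with `θ` (`enorm_integral_smul_complexify_oseenDuhamel_le`) and tends to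
zero along the dyadic kernels `η_j`, `j → -∞` (`tendsto_oseenLowFreqDefect_atBot`). [folklore] -/
def oseenLowFreqDefect (ν s t : ℝ) (θ : EuclideanSpace ℝ ι → ℂ) : ℝ≥0∞ :=
  ∫⁻ τ in Ioo s t, ∫⁻ z, ENNReal.ofReal (oseenMajorant (EuclideanSpace ℝ ι) (ν * (t - τ)) z) *
    ENNReal.ofReal (translationModulus θ z)

/-- **The large-scale means of the Duhamel term are controlled by the defect functional**:
for every continuous integrable bounded test kernel `θ` and every centre `y₀`,
`‖∫ θ(x - y₀) B^ν_s(u,v)(t)(x) dx‖ ≤ M_u M_v Φ(θ)`, uniformly in `y₀` — Fubini, the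
cancellation `∫ K = 0` under the kernel, the bound (14), and Tonelli. [folklore] -/
theorem enorm_integral_smul_complexify_oseenDuhamel_le (hν : 0 < ν) (hst : s ≤ t)
    (hu : AEStronglyMeasurable (uncurry u) (volume.restrict (Ioo s t ×ˢ univ)))
    (hv : AEStronglyMeasurable (uncurry v) (volume.restrict (Ioo s t ×ˢ univ)))
    (huM : ∀ τ ∈ Ioo s t, ∀ y, ‖u τ y‖ ≤ Mu) (hvM : ∀ τ ∈ Ioo s t, ∀ y, ‖v τ y‖ ≤ Mv)
    (hMu : 0 ≤ Mu) (hMv : 0 ≤ Mv) {θ : EuclideanSpace ℝ ι → ℂ} (hθc : Continuous θ)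
    (hθi : Integrable θ) (hθb : ∃ B, ∀ x, ‖θ x‖ ≤ B) (y₀ : EuclideanSpace ℝ ι) :
    ‖∫ x, θ (x - y₀) • FunctionSpaces.EuclideanSpace.complexify (oseenDuhamel ν s u v t x)‖ₑ ≤
      ENNReal.ofReal (Mu * Mv) * oseenLowFreqDefect ι ν s t θ := by
  -- the translated kernel
  set θ' : EuclideanSpace ℝ ι → ℂ := fun x => θ (x - y₀) with hθ'
  have hθ'c : Continuous θ' := hθc.comp (continuous_id.sub continuous_const)
  have hθ'i : Integrable θ' := hθi.comp_sub_right y₀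
  have hθ'b : ∃ B, ∀ x, ‖θ' x‖ ≤ B := hθb.imp fun B hB x => hB _
  have hMM : 0 ≤ Mu * Mv := mul_nonneg hMu hMv
  rw [integral_smul_complexify_oseenDuhamel_eq hν hst hu hv huM hvM hMu hMv hθ'c hθ'i]
  refine (enorm_integral_le_lintegral_enorm _).trans ?_
  -- the inner `y`-integrals are translation moduli of `θ`
  have hmeasK : Measurable (fun q : EuclideanSpace ℝ ι × EuclideanSpace ℝ ι =>
      ‖θ' (q.2 + q.1) - θ' q.1‖ₑ) :=
    ((hθ'c.comp (continuous_snd.add continuous_fst)).sub (hθ'c.comp continuous_fst)).measurable.enorm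
  have hΩ : ∀ z, ∫⁻ y, ‖θ' (z + y) - θ' y‖ₑ = ENNReal.ofReal (translationModulus θ z) := by
    intro z
    have e1 : translationModulus θ z = ∫ w, ‖θ' (w + z) - θ' w‖ :=
      (translationModulus_comp_sub_right θ y₀ z).symm
    have e2 := ofReal_integral_norm_eq_lintegral_enorm ((hθ'i.comp_add_right z).sub hθ'i)
    simp only [Pi.sub_apply] at e2
    rw [e1, e2]
    exact lintegral_congr fun y => by rw [add_comm]
  -- measurability of `p ↦ ∫ θ' • (F · p)` (the swapped Fubini integrand)
  have hsw : AEStronglyMeasurable (fun p : ℝ × EuclideanSpace ℝ ι => ∫ x, θ' x •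
      FunctionSpaces.EuclideanSpace.complexify
        (oseenKernel (ν * (t - p.1)) (x - p.2) (u p.1 p.2) (v p.1 p.2)))
      ((volume.restrict (Ioo s t)).prod (volume : Measure (EuclideanSpace ℝ ι))) := by
    have hF2 := (FunctionSpaces.EuclideanSpace.complexify (ι := ι)).continuous.comp_aestronglyMeasurable
      (aestronglyMeasurable_oseenKernel_fields_prod (ν := ν) (t := t) hu hv)
    have hH : AEStronglyMeasurable (fun q : EuclideanSpace ℝ ι × (ℝ × EuclideanSpace ℝ ι) =>
        θ' q.1 • FunctionSpaces.EuclideanSpace.complexify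
          (oseenKernel (ν * (t - q.2.1)) (q.1 - q.2.2) (u q.2.1 q.2.2) (v q.2.1 q.2.2)))
        ((volume : Measure (EuclideanSpace ℝ ι)).prod
          ((volume.restrict (Ioo s t)).prod (volume : Measure (EuclideanSpace ℝ ι)))) :=
      (hθ'c.comp_aestronglyMeasurable measurable_fst.aestronglyMeasurable).smul hF2
    exact hH.prod_swap.integral_prod_right'
  rw [lintegral_prod _ hsw.aemeasurable.enorm]
  -- pointwise bound on `(s,t) × E`, then Tonelli
  calc ∫⁻ τ in Ioo s t, ∫⁻ y, ‖∫ x, θ' x • FunctionSpaces.EuclideanSpace.complexify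
          (oseenKernel (ν * (t - (τ, y).1)) (x - (τ, y).2) (u (τ, y).1 (τ, y).2)
            (v (τ, y).1 (τ, y).2))‖ₑ
      ≤ ∫⁻ τ in Ioo s t, ∫⁻ y, ENNReal.ofReal (Mu * Mv) * ∫⁻ z, ‖θ' (z + y) - θ' y‖ₑ *
          ENNReal.ofReal (oseenMajorant (EuclideanSpace ℝ ι) (ν * (t - τ)) z) := by
        refine setLIntegral_mono' measurableSet_Ioo fun τ hτ => lintegral_mono fun y => ?_
        exact enorm_integral_smul_complexify_oseenKernel_le (mul_pos hν (sub_pos.2 hτ.2)) hθ'c hθ'b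
          y (huM τ hτ y) (hvM τ hτ y) hMu hMv
    _ = ENNReal.ofReal (Mu * Mv) * ∫⁻ τ in Ioo s t, ∫⁻ z,
          ENNReal.ofReal (oseenMajorant (EuclideanSpace ℝ ι) (ν * (t - τ)) z) *
            ∫⁻ y, ‖θ' (z + y) - θ' y‖ₑ := by
        rw [← lintegral_const_mul' _ _ ENNReal.ofReal_ne_top]
        refine lintegral_congr fun τ => ?_
        rw [lintegral_const_mul' _ _ ENNReal.ofReal_ne_top]
        congr 1
        -- swap `y` and `z`, pull the majorant out of the `y`-integral
        rw [lintegral_lintegral_swap]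
        · refine lintegral_congr fun z => ?_
          rw [lintegral_mul_const' _ _ ENNReal.ofReal_ne_top, mul_comm]
        · exact (hmeasK.mul ((measurable_oseenMajorant_uncurry.comp
            (measurable_const.prodMk measurable_snd)).ennreal_ofReal)).aemeasurable
    _ = ENNReal.ofReal (Mu * Mv) * oseenLowFreqDefect ι ν s t θ := by
        unfold oseenLowFreqDefect
        congr 1
        refine lintegral_congr fun τ => lintegral_congr fun z => ?_
        rw [hΩ z]

end Tested

/-! ## The defect functional along the dyadic kernels tends to zero; the main theorem -/

section LowFrequency

variable {ι : Type*} [Fintype ι]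

variable {ν s t Mu Mv : ℝ} {u v : ℝ → EuclideanSpace ℝ ι → EuclideanSpace ℝ ι}

/-- The defect functional with the majorant integrated out: for a constant `c`,
`∫⁻_{(s,t)} ∫⁻ k(ν(t-τ), z) c dz dτ = c · m ν^{-1/2} 2 (t-s)^{1/2}`. [folklore] -/
theorem lintegral_Ioo_lintegral_oseenMajorant_mul_const (hν : 0 < ν) (hst : s ≤ t) (c : ℝ≥0∞) :
    ∫⁻ τ in Ioo s t, ∫⁻ z, ENNReal.ofReal (oseenMajorant (EuclideanSpace ℝ ι) (ν * (t - τ)) z) * c =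
      c * ENNReal.ofReal (oseenMajorantMass (EuclideanSpace ℝ ι) *
        (ν ^ (-(1 / 2 : ℝ)) * (2 * (t - s) ^ (1 / 2 : ℝ)))) := by
  have h1 : ∀ τ ∈ Ioo s t,
      ∫⁻ z, ENNReal.ofReal (oseenMajorant (EuclideanSpace ℝ ι) (ν * (t - τ)) z) * c =
        c * (ENNReal.ofReal (oseenMajorantMass (EuclideanSpace ℝ ι)) *
          ENNReal.ofReal ((ν * (t - τ)) ^ (-(1 / 2 : ℝ)))) := by
    intro τ hτ
    have hm : AEMeasurable (fun z : EuclideanSpace ℝ ι =>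
        ENNReal.ofReal (oseenMajorant (EuclideanSpace ℝ ι) (ν * (t - τ)) z)) volume :=
      (measurable_oseenMajorant_uncurry.comp
        (measurable_const.prodMk measurable_id)).ennreal_ofReal.aemeasurable
    rw [lintegral_mul_const'' _ hm, lintegral_oseenMajorant (mul_pos hν (sub_pos.2 hτ.2)),
      ENNReal.ofReal_mul oseenMajorantMass_pos.le, mul_comm]
  have hmeas : AEMeasurable (fun τ : ℝ => ENNReal.ofReal (oseenMajorantMass (EuclideanSpace ℝ ι)) *
      ENNReal.ofReal ((ν * (t - τ)) ^ (-(1 / 2 : ℝ)))) (volume.restrict (Ioo s t)) :=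
    (((measurable_const.mul (measurable_const.sub measurable_id)).pow_const _).ennreal_ofReal.const_mul
      _).aemeasurable
  rw [setLIntegral_congr_fun measurableSet_Ioo h1, lintegral_const_mul'' _ hmeas,
    lintegral_const_mul' _ _ ENNReal.ofReal_ne_top, lintegral_Ioo_viscousWeight hν hst,
    ← ENNReal.ofReal_mul oseenMajorantMass_pos.le]

/-- **Uniform bound for the defect functional**: if `Ω_θ ≤ B` then
`Φ(θ) ≤ B m ν^{-1/2} 2 (t-s)^{1/2} < ∞`. [folklore] -/
theorem oseenLowFreqDefect_le (hν : 0 < ν) (hst : s ≤ t) {θ : EuclideanSpace ℝ ι → ℂ} {B : ℝ}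
    (hB : ∀ z, translationModulus θ z ≤ B) :
    oseenLowFreqDefect ι ν s t θ ≤ ENNReal.ofReal B *
      ENNReal.ofReal (oseenMajorantMass (EuclideanSpace ℝ ι) *
        (ν ^ (-(1 / 2 : ℝ)) * (2 * (t - s) ^ (1 / 2 : ℝ)))) := by
  rw [← lintegral_Ioo_lintegral_oseenMajorant_mul_const hν hst]
  unfold oseenLowFreqDefect
  refine lintegral_mono fun τ => lintegral_mono fun z => ?_
  gcongr
  exact hB z

/-- The defect functional is finite on the dyadic kernels (indeed uniformly bounded in `j`). [folklore] -/
theorem oseenLowFreqDefect_lowFreqFourierKernel_lt_top (hν : 0 < ν) (hst : s ≤ t) (j : ℤ) :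
    oseenLowFreqDefect ι ν s t (lowFreqFourierKernel (EuclideanSpace ℝ ι) j) < ∞ :=
  (oseenLowFreqDefect_le hν hst (translationModulus_lowFreqFourierKernel_le j)).trans_lt
    (ENNReal.mul_lt_top ENNReal.ofReal_lt_top ENNReal.ofReal_lt_top)

/-- **The defect functional vanishes in the large-scale limit** (dominated convergence on
`(s, t) × E`: the integrand `k(ν(t-τ), z) Ω_{η_j}(z)` tends to `0` pointwise since
`Ω_{η_j}(z) = Ω_{η₀}(2^j z) → 0`, and is dominated by `2‖η₀‖_{L¹} k`, which is integrable):
`Φ(η_j) → 0` as `j → -∞`. [folklore] -/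
theorem tendsto_oseenLowFreqDefect_atBot (hν : 0 < ν) (hst : s ≤ t) :
    Tendsto (fun j : ℤ => oseenLowFreqDefect ι ν s t (lowFreqFourierKernel (EuclideanSpace ℝ ι) j))
      atBot (𝓝 0) := by
  set μ' : Measure (ℝ × EuclideanSpace ℝ ι) :=
    (volume.restrict (Ioo s t)).prod (volume : Measure (EuclideanSpace ℝ ι)) with hμ'
  set K : ℝ × EuclideanSpace ℝ ι → ℝ≥0∞ := fun q =>
    ENNReal.ofReal (oseenMajorant (EuclideanSpace ℝ ι) (ν * (t - q.1)) q.2) with hK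
  set G : ℤ → ℝ × EuclideanSpace ℝ ι → ℝ≥0∞ := fun j q =>
    K q * ENNReal.ofReal (translationModulus (lowFreqFourierKernel (EuclideanSpace ℝ ι) j) q.2) with hG
  have hKm : Measurable K :=
    (measurable_oseenMajorant_uncurry.comp
      ((measurable_const.mul (measurable_const.sub measurable_fst)).prodMk measurable_snd)).ennreal_ofReal
  have hGm : ∀ j, Measurable (G j) := fun j =>
    hKm.mul ((schwartz_continuous_translationModulus _).measurable.comp measurable_snd).ennreal_ofReal
  -- the defect as a product integral
  have hrepr : ∀ j, oseenLowFreqDefect ι ν s t (lowFreqFourierKernel (EuclideanSpace ℝ ι) j) =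
      ∫⁻ q, G j q ∂μ' := fun j => by
    rw [hμ', lintegral_prod _ (hGm j).aemeasurable]
    rfl
  simp_rw [hrepr]
  -- dominated convergence
  set c : ℝ≥0∞ := ENNReal.ofReal (2 * ∫ w, ‖lowFreqFourierKernel (EuclideanSpace ℝ ι) 0 w‖) with hc
  have hfin : ∫⁻ q, K q * c ∂μ' ≠ ∞ := by
    rw [hμ', lintegral_prod _ (hKm.mul_const c).aemeasurable]
    change ∫⁻ τ in Ioo s t, ∫⁻ z, ENNReal.ofReal
      (oseenMajorant (EuclideanSpace ℝ ι) (ν * (t - τ)) z) * c ≠ ∞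
    rw [lintegral_Ioo_lintegral_oseenMajorant_mul_const hν hst]
    exact ENNReal.mul_ne_top ENNReal.ofReal_ne_top ENNReal.ofReal_ne_top
  have hlim : ∀ q, Tendsto (fun j => G j q) atBot (𝓝 0) := by
    intro q
    have h1 : Tendsto (fun j : ℤ => ENNReal.ofReal
        (translationModulus (lowFreqFourierKernel (EuclideanSpace ℝ ι) j) q.2)) atBot (𝓝 0) := by
      have h := (ENNReal.continuous_ofReal.tendsto 0).comp
        (tendsto_translationModulus_lowFreqFourierKernel_atBot (E := EuclideanSpace ℝ ι) q.2)
      rwa [ENNReal.ofReal_zero] at h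
    have h2 := ENNReal.Tendsto.const_mul h1 (Or.inr (ENNReal.ofReal_ne_top : K q ≠ ∞))
    rwa [mul_zero] at h2
  have h := tendsto_lintegral_filter_of_dominated_convergence (μ := μ') (l := atBot)
    (F := G) (f := fun _ => 0) (fun q => K q * c) (Eventually.of_forall hGm)
    (Eventually.of_forall fun j => ae_of_all _ fun q => ?_) hfin (ae_of_all _ hlim)
  · simpa using h
  · rw [hG, hc]
    dsimp only
    gcongr
    exact translationModulus_lowFreqFourierKernel_le j q.2

/-- **A tempered distribution for the Duhamel term.** The Duhamel term of bounded measurable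
fields is bounded and measurable, hence is represented by a tempered distribution
(`IsDistributionOf`; BCD §1.2, `L^∞ ⊂ 𝓢'`). [folklore] -/
theorem exists_isDistributionOf_oseenDuhamel (hν : 0 < ν) (hst : s ≤ t)
    (hu : AEStronglyMeasurable (uncurry u) (volume.restrict (Ioo s t ×ˢ univ)))
    (hv : AEStronglyMeasurable (uncurry v) (volume.restrict (Ioo s t ×ˢ univ)))
    (huM : ∀ τ ∈ Ioo s t, ∀ y, ‖u τ y‖ ≤ Mu) (hvM : ∀ τ ∈ Ioo s t, ∀ y, ‖v τ y‖ ≤ Mv)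
    (hMu : 0 ≤ Mu) (hMv : 0 ≤ Mv) :
    ∃ V : 𝓢'(EuclideanSpace ℝ ι, EuclideanSpace ℂ ι), IsDistributionOf (oseenDuhamel ν s u v t) V := by
  set g : EuclideanSpace ℝ ι → EuclideanSpace ℂ ι :=
    fun x => FunctionSpaces.EuclideanSpace.complexify (oseenDuhamel ν s u v t x) with hg
  have hgm : MemLp g ∞ (volume : Measure (EuclideanSpace ℝ ι)) := by
    refine memLp_top_of_bound ((FunctionSpaces.EuclideanSpace.complexify (ι := ι)).continuous
      |>.comp_aestronglyMeasurable
        (aestronglyMeasurable_oseenDuhamel_of_bound hν hst hu hv huM hvM hMu hMv))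
      (Mu * Mv * oseenMajorantMass (EuclideanSpace ℝ ι) *
        (ν ^ (-(1 / 2 : ℝ)) * (2 * (t - s) ^ (1 / 2 : ℝ))))
      (Eventually.of_forall fun x => ?_)
    rw [hg]
    dsimp only
    rw [FunctionSpaces.EuclideanSpace.norm_complexify]
    exact norm_oseenDuhamel_le_of_bound hν hst hu hv huM hvM hMu hMv x
  refine ⟨Lp.toTemperedDistribution (hgm.toLp g), fun φ => ⟨?_, ?_⟩⟩
  · exact φ.integrable.smul_of_top_left hgm
  · rw [Lp.toTemperedDistribution_apply]
    refine integral_congr_ae ?_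
    filter_upwards [hgm.coeFn_toLp] with x hx
    rw [hx]

/-- **The pairing formula**: for a field `g` bounded and measurable with distribution `V`,
`⟨Ṡ_j V, φ⟩ = ∫ φ(y) (∫ η_j(x - y) g(x) dx) dy` (the cut-off acts on the test side through
`φ ⋆ η_j`, then Fubini). [folklore] -/
theorem lowFreqCutoff_apply_eq_of_isDistributionOf {g : EuclideanSpace ℝ ι → EuclideanSpace ℝ ι}
    (hgm : AEStronglyMeasurable g volume) {B : ℝ} (hgB : ∀ x, ‖g x‖ ≤ B)
    {V : 𝓢'(EuclideanSpace ℝ ι, EuclideanSpace ℂ ι)} (hV : IsDistributionOf g V) (j : ℤ)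
    (φ : 𝓢(EuclideanSpace ℝ ι, ℂ)) :
    FunctionSpaces.lowFreqCutoff j V φ =
      ∫ y, φ y • ∫ x, lowFreqFourierKernel (EuclideanSpace ℝ ι) j (x - y) •
        FunctionSpaces.EuclideanSpace.complexify (g x) := by
  set gc : EuclideanSpace ℝ ι → EuclideanSpace ℂ ι :=
    fun x => FunctionSpaces.EuclideanSpace.complexify (g x) with hgc
  have hgcm : MemLp gc ∞ (volume : Measure (EuclideanSpace ℝ ι)) := by
    refine memLp_top_of_bound
      ((FunctionSpaces.EuclideanSpace.complexify (ι := ι)).continuous.comp_aestronglyMeasurable hgm)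
      B (Eventually.of_forall fun x => ?_)
    rw [hgc]
    dsimp only
    rw [FunctionSpaces.EuclideanSpace.norm_complexify]
    exact hgB x
  set f : Lp (EuclideanSpace ℂ ι) ∞ (volume : Measure (EuclideanSpace ℝ ι)) := hgcm.toLp gc with hf
  have hfg : (f : EuclideanSpace ℝ ι → EuclideanSpace ℂ ι) =ᵐ[volume] gc := hgcm.coeFn_toLp
  rw [FunctionSpaces.lowFreqCutoff_apply, TemperedDistribution.fourierMultiplierCLM_apply_apply,
    (hV _).2]
  simp_rw [fourier_lowFreqSymbol_smul_fourierInv_apply]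
  have h1 : ∫ x, (∫ y, φ y * lowFreqFourierKernel (EuclideanSpace ℝ ι) j (x - y)) • gc x =
      ∫ x, (∫ y, φ y * lowFreqFourierKernel (EuclideanSpace ℝ ι) j (x - y)) •
        (f : EuclideanSpace ℝ ι → EuclideanSpace ℂ ι) x := by
    refine integral_congr_ae ?_
    filter_upwards [hfg] with x hx
    rw [hx]
  have h2 : ∀ y, ∫ x, lowFreqFourierKernel (EuclideanSpace ℝ ι) j (x - y) •
      (f : EuclideanSpace ℝ ι → EuclideanSpace ℂ ι) x =
        ∫ x, lowFreqFourierKernel (EuclideanSpace ℝ ι) j (x - y) • gc x := fun y => by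
    refine integral_congr_ae ?_
    filter_upwards [hfg] with x hx
    rw [hx]
  change ∫ x, (∫ y, φ y * lowFreqFourierKernel (EuclideanSpace ℝ ι) j (x - y)) • gc x =
    ∫ y, φ y • ∫ x, lowFreqFourierKernel (EuclideanSpace ℝ ι) j (x - y) • gc x
  rw [h1, FunctionSpaces.integral_integral_smul_Lp_swap f φ (lowFreqFourierKernel (EuclideanSpace ℝ ι) j)]
  simp_rw [h2]

/-- **The Oseen–Duhamel term of bounded fields has no large-scale mean: `Ṡ_j B^ν_s(u, v)(t) → 0`
in `𝓢'` as `j → -∞`.** Let `ν > 0`, `s ≤ t`, and let `u`, `v` be jointly measurable fields on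
`(s, t) × ℝ^ι` bounded by `M_u`, `M_v`. If `V` is the tempered distribution of the bilinear
Duhamel term `x ↦ B^ν_s(u, v)(t)(x) = ∫_{(s,t)} ∫ K(ν(t-τ), x-y)[u(τ,y), v(τ,y)] dy dτ`
(`oseenDuhamel`, Koch–Nadirashvili–Seregin–Šverák 2009, §4 p. 8), then the low-frequency
cut-offs `Ṡ_j V` (Bahouri–Chemin–Danchin (2.5)) tend to `0` in `𝓢'` as `j → -∞`, i.e. `V`
satisfies the realisation condition of the homogeneous Besov spaces (BCD Def. 1.26) — although
`B^ν_s(u,v)(t)` is merely bounded (for bounded functions the condition fails in general: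
`Ṡ_j c = c`). Mechanism: `⟨Ṡ_j V, φ⟩ = ∫ φ(y) ⟨η_j(· - y), B⟩ dy` with `η_j = 𝓕χ(2^{-j}·)`, and
each large-scale mean `⟨η_j(· - y), B⟩` is bounded, uniformly in `y`, by `M_u M_v Φ(η_j)`,
where the defect `Φ(η_j) = ∫∫ k(ν(t-τ), z) Ω_{η_j}(z) → 0` because the Oseen kernel has mean
zero (`∫ K(σ, z) dz = 0`, the kernel being odd in `z`) and `Ω_{η_j}(z) = Ω_{η₀}(2^j z) → 0`. This is the low-frequency input for identifying a bounded
Besov mild solution with its Oseen integral form without parasitic drift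
(`oseenMild_of_bounded_isBesovMildSolutionOn`, `NSBoundedMildOseen.lean`). [folklore] -/
theorem tendsto_lowFreqCutoff_oseenDuhamel_atBot (hν : 0 < ν) (hst : s ≤ t)
    (hu : AEStronglyMeasurable (uncurry u) (volume.restrict (Ioo s t ×ˢ univ)))
    (hv : AEStronglyMeasurable (uncurry v) (volume.restrict (Ioo s t ×ˢ univ)))
    (huM : ∀ τ ∈ Ioo s t, ∀ y, ‖u τ y‖ ≤ Mu) (hvM : ∀ τ ∈ Ioo s t, ∀ y, ‖v τ y‖ ≤ Mv)
    (hMu : 0 ≤ Mu) (hMv : 0 ≤ Mv) {V : 𝓢'(EuclideanSpace ℝ ι, EuclideanSpace ℂ ι)}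
    (hV : IsDistributionOf (oseenDuhamel ν s u v t) V) :
    Tendsto (fun j : ℤ => FunctionSpaces.lowFreqCutoff j V) atBot (𝓝 0) := by
  rw [PointwiseConvergenceCLM.tendsto_iff_forall_tendsto]
  intro φ
  have h0 : (0 : 𝓢'(EuclideanSpace ℝ ι, EuclideanSpace ℂ ι)) φ = 0 := rfl
  rw [h0, tendsto_zero_iff_norm_tendsto_zero]
  set η : ℤ → 𝓢(EuclideanSpace ℝ ι, ℂ) := fun j => lowFreqFourierKernel (EuclideanSpace ℝ ι) j
    with hη
  set Φ : ℤ → ℝ≥0∞ := fun j => ENNReal.ofReal (Mu * Mv) * oseenLowFreqDefect ι ν s t (η j) with hΦ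
  have hΦtop : ∀ j, Φ j ≠ ∞ := fun j => ENNReal.mul_ne_top ENNReal.ofReal_ne_top
    (oseenLowFreqDefect_lowFreqFourierKernel_lt_top hν hst j).ne
  -- the pairing formula and the uniform bound on the large-scale means
  have hpair : ∀ j, FunctionSpaces.lowFreqCutoff j V φ =
      ∫ y, φ y • ∫ x, η j (x - y) • FunctionSpaces.EuclideanSpace.complexify
        (oseenDuhamel ν s u v t x) := fun j =>
    lowFreqCutoff_apply_eq_of_isDistributionOf
      (aestronglyMeasurable_oseenDuhamel_of_bound hν hst hu hv huM hvM hMu hMv)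
      (norm_oseenDuhamel_le_of_bound hν hst hu hv huM hvM hMu hMv) hV j φ
  have hmean : ∀ j y, ‖∫ x, η j (x - y) • FunctionSpaces.EuclideanSpace.complexify
      (oseenDuhamel ν s u v t x)‖ ≤ (Φ j).toReal := by
    intro j y
    have h := enorm_integral_smul_complexify_oseenDuhamel_le hν hst hu hv huM hvM hMu hMv
      (η j).continuous (η j).integrable ⟨_, fun x => SchwartzMap.norm_le_seminorm ℂ (η j) x⟩ y
    rw [← toReal_enorm]
    exact ENNReal.toReal_mono (hΦtop j) h
  -- squeeze
  have hlim : Tendsto (fun j => (∫ y, ‖φ y‖) * (Φ j).toReal) atBot (𝓝 0) := by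
    have h1 : Tendsto Φ atBot (𝓝 0) := by
      have h := ENNReal.Tendsto.const_mul (tendsto_oseenLowFreqDefect_atBot (ι := ι) hν hst)
        (Or.inr (ENNReal.ofReal_ne_top : ENNReal.ofReal (Mu * Mv) ≠ ∞))
      rwa [mul_zero] at h
    have h2 : Tendsto (fun j => (Φ j).toReal) atBot (𝓝 0) := by
      have h := (ENNReal.tendsto_toReal ENNReal.zero_ne_top).comp h1
      rwa [ENNReal.toReal_zero] at h
    simpa using h2.const_mul (∫ y, ‖φ y‖)
  refine squeeze_zero (fun j => norm_nonneg _) (fun j => ?_) hlim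
  rw [hpair j]
  refine (norm_integral_le_of_norm_le ((φ.integrable.norm).mul_const _)
    (Eventually.of_forall fun y => ?_)).trans (le_of_eq (integral_mul_const _ _))
  rw [norm_smul]
  exact mul_le_mul_of_nonneg_left (hmean j y) (norm_nonneg _)

/-- **The Duhamel term only sees the fields almost everywhere**: if `u = u'` and `v = v'`
slice-wise a.e. on `(s, t)`, then `B^ν_s(u, v)(t) = B^ν_s(u', v')(t)` everywhere (the inner
`y`-integrals agree for every `τ`). [folklore] -/
theorem oseenDuhamel_congr_ae {u' v' : ℝ → EuclideanSpace ℝ ι → EuclideanSpace ℝ ι}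
    (hu : ∀ τ ∈ Ioo s t, u τ =ᵐ[volume] u' τ) (hv : ∀ τ ∈ Ioo s t, v τ =ᵐ[volume] v' τ) :
    oseenDuhamel ν s u v t = oseenDuhamel ν s u' v' t := by
  funext x
  rw [oseenDuhamel_apply, oseenDuhamel_apply]
  refine setIntegral_congr_fun measurableSet_Ioo fun τ hτ => integral_congr_ae ?_
  filter_upwards [hu τ hτ, hv τ hτ] with y hy hy'
  rw [hy, hy']

/-- **Essentially bounded form of the main theorem** (the hypotheses of the smoothing chain of
`NSBoundedMildOseen.lean`: slices essentially bounded on `(s, t)`, slice-wise and jointly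
measurable). The fields are replaced by their bounded radial retractions, which agree with them
slice-wise a.e. (`radialRetract_eq_self`) and hence have the same Duhamel term
(`oseenDuhamel_congr_ae`); then `tendsto_lowFreqCutoff_oseenDuhamel_atBot` applies. [folklore] -/
theorem tendsto_lowFreqCutoff_oseenDuhamel_atBot_of_eLpNorm_le (hν : 0 < ν) (hst : s ≤ t) {M : ℝ}
    (hu : AEStronglyMeasurable (uncurry u) (volume.restrict (Ioo s t ×ˢ univ)))
    (hv : AEStronglyMeasurable (uncurry v) (volume.restrict (Ioo s t ×ˢ univ)))
    (hub : ∀ τ ∈ Ioo s t, eLpNorm (u τ) ∞ volume ≤ ENNReal.ofReal M)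
    (hvb : ∀ τ ∈ Ioo s t, eLpNorm (v τ) ∞ volume ≤ ENNReal.ofReal M)
    {V : 𝓢'(EuclideanSpace ℝ ι, EuclideanSpace ℂ ι)} (hV : IsDistributionOf (oseenDuhamel ν s u v t) V) :
    Tendsto (fun j : ℤ => FunctionSpaces.lowFreqCutoff j V) atBot (𝓝 0) := by
  -- a positive bound `M' = max M 0 + 1` and the radial retraction onto the ball of radius `M'`
  set M' : ℝ := max M 0 + 1 with hM'
  have hM'0 : 0 < M' := by rw [hM']; positivity
  have hMM' : ENNReal.ofReal M ≤ ENNReal.ofReal M' :=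
    ENNReal.ofReal_le_ofReal (by rw [hM']; linarith [le_max_left M 0])
  set ρ : EuclideanSpace ℝ ι → EuclideanSpace ℝ ι := fun w => (M' / max M' ‖w‖) • w with hρ
  have hρc : Continuous ρ := continuous_radialRetract hM'0
  set u' : ℝ → EuclideanSpace ℝ ι → EuclideanSpace ℝ ι := fun τ y => ρ (u τ y) with hu'
  set v' : ℝ → EuclideanSpace ℝ ι → EuclideanSpace ℝ ι := fun τ y => ρ (v τ y) with hv'
  have hae : ∀ {w : ℝ → EuclideanSpace ℝ ι → EuclideanSpace ℝ ι},
      (∀ τ ∈ Ioo s t, eLpNorm (w τ) ∞ volume ≤ ENNReal.ofReal M) →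
        ∀ τ ∈ Ioo s t, w τ =ᵐ[volume] fun y => ρ (w τ y) := by
    intro w hw τ hτ
    have hae : ∀ᵐ y ∂(volume : Measure (EuclideanSpace ℝ ι)), ‖w τ y‖ₑ ≤ ENNReal.ofReal M' :=
      (ae_le_eLpNormEssSup (f := w τ)).mono fun y hy =>
        hy.trans (by rw [← eLpNorm_exponent_top]; exact (hw τ hτ).trans hMM')
    filter_upwards [hae] with y hy
    have hy' : ‖w τ y‖ ≤ M' := by
      rw [← ofReal_norm] at hy
      exact (ENNReal.ofReal_le_ofReal_iff hM'0.le).1 hy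
    exact (radialRetract_eq_self hM'0 hy').symm
  have heq : oseenDuhamel ν s u v t = oseenDuhamel ν s u' v' t :=
    oseenDuhamel_congr_ae (hae hub) (hae hvb)
  rw [heq] at hV
  exact tendsto_lowFreqCutoff_oseenDuhamel_atBot hν hst (hρc.comp_aestronglyMeasurable hu)
    (hρc.comp_aestronglyMeasurable hv) (fun τ _ y => norm_radialRetract_le hM'0 _)
    (fun τ _ y => norm_radialRetract_le hM'0 _) hM'0.le hM'0.le hV

end LowFrequency

end Literature.Analysis.FluidPDE

end
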